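import Mathlib
import Summits.Ventures.HodgeRepro.GaussSumProductLocal
import Summits.Ventures.HodgeRepro.OcticCMPointTameSign
import Summits.Ventures.HodgeRepro.OcticCMPointKappa
import Summits.Ventures.HodgeRepro.OcticCMPointConjDual

/-!
# OcticCMPointDeepSign — `ε(½, ω) = ±1` at EVERY conductor on gen 1's model

Blind re-derivation cell `pub-hodge-repro`, seat night-2 (gen 3).  Target tree path
`lean/Summits/Ventures/HodgeRepro/OcticCMPointDeepSign.lean`.  Puts `GaussSumProductLocal.lean`'s product formula
`𝔤(χ) 𝔤(χ⁻¹) = χ(−1) · |R|` on a finite local ring into gen 1's model `LocalChar R`, `eps` (Kudla Prop 3.8 (ii) / (3.32),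
p0109), with the named hypotheses `HalfNormalised` (`κ² |R| = 1`, the `s = ½` normalisation) and `ConjDual` (ROUTE-B
§9.9 (f) on Kudla (3.29)) of `OcticCMPointTameSign.lean`: for a primitive `ω` of any conductor, `ε(½, ω) = ±1`
(`eps_eq_one_or_neg_one_local`).  So the right side of (E2)'s local equation `ω_v(a_j) = ε_v(½, χ′_j, ψ_δ)` at the three
places of `S₃` of the octic point is a sign also for the deep-conductor characters the stability twist of gen 1
produces (`c ≥ 2 · max_j a(χ′_j)`), not only for the tame ones.  With `OcticCMPointKappa.lean` (`κ = kappaHalf R`, the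
page's normalisation) and `OcticCMPointConjDual.lean` (`ConjDual` from the conjugation) the statement becomes
`eps_kappaHalf_eq_one_or_neg_one`: `ε(½, ω) = ±1` with NO normalisation hypothesis left — only the model transcription
(`hloc`, `A ⊆ 𝔪`, `A · A = 0`, `ψ` primitive, `ω` primitive, the conjugation data `σ, s, t`).  Also on the kernel: the
PRINTED `𝔤(ω, ψ) 𝔤(ω, ψ)‾ = 1` of Kudla p0109:L35 in the form `gaussSum · star gaussSum = |R|` (`gaussSum_mul_star`) and
`‖ε(½, ω)‖ = 1` for unitary `ω` (`norm_eps_kappaHalf`).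

**What this is not.**  The model hypotheses transcribe `𝒪/𝔭^c`, `c ≥ 2`; the four `χ′_j` are on no page; no sign is
evaluated.  Nothing here says anything about the status of the Hodge conjecture for CM abelian varieties, which is
NOT proved.
-/

set_option autoImplicit false

noncomputable section

open Finset Classical

namespace Summit.Ventures.HodgeRepro.PeriodCloser

open GaussSumStability

namespace LocalChar

variable {R : Type} [CommRing R] [Fintype R]

/-- **`ε(ω) ε(ω⁻¹) = κ² ω(−1) |R|` on the local-ring model** for a primitive `ω` (its unit part is non-trivial on
`1 + A`; `ω(ϖ) ≠ 0`). -/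
theorem eps_mul_eps_inv_local (κ : ℂ) (n : ℕ) (ω : LocalChar R) (ψ : AddChar R ℂ) (hψ : ψ.IsPrimitive)
    (𝔪 : Ideal R) (hloc : ∀ x : R, x ∈ 𝔪 ↔ ¬ IsUnit x) (hA : ∀ t, PsiAnn ψ 𝔪 t → t ∈ 𝔪)
    (hsq : ∀ t t', PsiAnn ψ 𝔪 t → PsiAnn ψ 𝔪 t' → t * t' = 0)
    (hprim : ∃ z₀, PsiAnn ψ 𝔪 z₀ ∧ ω.unit (1 + z₀) ≠ 1) (hπ : ω.piVal ≠ 0) :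
    eps κ n ω ψ * eps κ n ω⁻¹ ψ = κ ^ 2 * ω.unit (-1) * (Fintype.card R : ℂ) := by
  have hprim' : ∃ z₀, PsiAnn ψ 𝔪 z₀ ∧ ω.unit⁻¹ (1 + z₀) ≠ 1 := by
    obtain ⟨z₀, hz₀, h⟩ := hprim
    refine ⟨z₀, hz₀, ?_⟩
    rw [MulChar.inv_apply_eq_inv']
    exact fun h1 => h (inv_eq_one.mp h1)
  have hg : gauss ω ψ * gauss ω⁻¹ ψ = ω.unit (-1) * (Fintype.card R : ℂ) := by
    unfold gauss
    rw [inv_unit, inv_inv]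
    have h := gaussSum_mul_gaussSum_inv_eq_card ψ hψ 𝔪 hloc hA hsq ω.unit⁻¹ hprim'
    rw [inv_inv, MulChar.inv_apply_eq_inv'] at h
    have hneg : (ω.unit (-1))⁻¹ = ω.unit (-1) := by
      have := unit_neg_one_sq ω
      exact inv_eq_of_mul_eq_one_right this
    rwa [hneg] at h
  unfold eps
  rw [inv_piVal]
  have hp : ω.piVal ^ n * ω.piVal⁻¹ ^ n = 1 := by
    rw [← mul_pow, mul_inv_cancel₀ hπ, one_pow]
  calc ω.piVal ^ n * κ * gauss ω ψ * (ω.piVal⁻¹ ^ n * κ * gauss ω⁻¹ ψ)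
      = (ω.piVal ^ n * ω.piVal⁻¹ ^ n) * (κ ^ 2 * (gauss ω ψ * gauss ω⁻¹ ψ)) := by ring
    _ = κ ^ 2 * ω.unit (-1) * (Fintype.card R : ℂ) := by rw [hp, hg]; ring

/-- **`ε(½, ω) = ±1` at every conductor**: for a primitive conjugate-dual `ω` on the local-ring model with the
`s = ½` normalisation, the local sign is a sign. -/
theorem eps_eq_one_or_neg_one_local (κ : ℂ) (n : ℕ) (ω : LocalChar R) (ψ : AddChar R ℂ)
    (hψ : ψ.IsPrimitive) (𝔪 : Ideal R) (hloc : ∀ x : R, x ∈ 𝔪 ↔ ¬ IsUnit x)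
    (hA : ∀ t, PsiAnn ψ 𝔪 t → t ∈ 𝔪) (hsq : ∀ t t', PsiAnn ψ 𝔪 t → PsiAnn ψ 𝔪 t' → t * t' = 0)
    (hprim : ∃ z₀, PsiAnn ψ 𝔪 z₀ ∧ ω.unit (1 + z₀) ≠ 1) (hπ : ω.piVal ≠ 0)
    (hκ : HalfNormalised (R := R) κ) (hcd : ConjDual κ n ω ψ) :
    eps κ n ω ψ = 1 ∨ eps κ n ω ψ = -1 := by
  have h := eps_mul_eps_inv_local κ n ω ψ hψ 𝔪 hloc hA hsq hprim hπ
  rw [mul_right_comm, hκ, one_mul, hcd] at h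
  have hu := unit_neg_one_sq ω
  have hsq1 : eps κ n ω ψ * eps κ n ω ψ = 1 := by
    calc eps κ n ω ψ * eps κ n ω ψ
        = (ω.unit (-1) * ω.unit (-1)) * (eps κ n ω ψ * eps κ n ω ψ) := by rw [hu, one_mul]
      _ = ω.unit (-1) * (eps κ n ω ψ * (ω.unit (-1) * eps κ n ω ψ)) := by ring
      _ = ω.unit (-1) * ω.unit (-1) := by rw [h]
      _ = 1 := hu
  exact mul_self_eq_one_iff.mp hsq1

/-- **`𝔤 · 𝔤̄ = |R|`** (Kudla p0109:L35 on the kernel, in Mathlib's normalisation): for `ψ` primitive and `χ` primitive on the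
local-ring model, `gaussSum χ ψ * star (gaussSum χ ψ) = |R|` — via `star_gaussSum_eq` (`star 𝔤(χ, ψ) = 𝔤(χ⁻¹, ψ⁻¹)`),
`ψ⁻¹ = mulShift ψ (−1)` and `gaussSum_mulShift_eq`, then the product formula. -/
theorem gaussSum_mul_star (ψ : AddChar R ℂ) (hψ : ψ.IsPrimitive) (𝔪 : Ideal R)
    (hloc : ∀ x : R, x ∈ 𝔪 ↔ ¬ IsUnit x) (hA : ∀ t, PsiAnn ψ 𝔪 t → t ∈ 𝔪)
    (hsq : ∀ t t', PsiAnn ψ 𝔪 t → PsiAnn ψ 𝔪 t' → t * t' = 0) (χ : MulChar R ℂ)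
    (hprim : ∃ z₀, PsiAnn ψ 𝔪 z₀ ∧ χ (1 + z₀) ≠ 1) :
    gaussSum χ ψ * star (gaussSum χ ψ) = (Fintype.card R : ℂ) := by
  have hm : ψ.mulShift (-1) = ψ.mulShift ((-1 : Rˣ) : R) := by rw [Units.val_neg, Units.val_one]
  rw [star_gaussSum_eq, AddChar.inv_mulShift, hm, gaussSum_mulShift_eq, inv_inv, Units.val_neg, Units.val_one,
    mul_left_comm, gaussSum_mul_gaussSum_inv_eq_card ψ hψ 𝔪 hloc hA hsq χ hprim, ← mul_assoc,
    ← map_mul, neg_one_mul, neg_neg, MulChar.map_one, one_mul]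

/-- **`‖ε(½, ω, ψ)‖ = 1`** for a unitary primitive `ω` with Kudla's normalisation `κ = kappaHalf R`: the printed
`𝔤 𝔤̄ = 1` of p0109:L35 transported to the model. -/
theorem norm_eps_kappaHalf (n : ℕ) (ω : LocalChar R) (ψ : AddChar R ℂ) (hψ : ψ.IsPrimitive) (𝔪 : Ideal R)
    (hloc : ∀ x : R, x ∈ 𝔪 ↔ ¬ IsUnit x) (hA : ∀ t, PsiAnn ψ 𝔪 t → t ∈ 𝔪)
    (hsq : ∀ t t', PsiAnn ψ 𝔪 t → PsiAnn ψ 𝔪 t' → t * t' = 0)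
    (hprim : ∃ z₀, PsiAnn ψ 𝔪 z₀ ∧ ω.unit (1 + z₀) ≠ 1) (hπ : ‖ω.piVal‖ = 1) :
    ‖eps (kappaHalf R) n ω ψ‖ = 1 := by
  haveI : Nonempty R := ⟨0⟩
  have hprim' : ∃ z₀, PsiAnn ψ 𝔪 z₀ ∧ ω.unit⁻¹ (1 + z₀) ≠ 1 := by
    obtain ⟨z₀, hz₀, h⟩ := hprim
    refine ⟨z₀, hz₀, ?_⟩
    rw [MulChar.inv_apply_eq_inv']
    exact fun h1 => h (inv_eq_one.mp h1)
  have hg : ‖gauss ω ψ‖ ^ 2 = (Fintype.card R : ℝ) := by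
    have h := gaussSum_mul_star ψ hψ 𝔪 hloc hA hsq ω.unit⁻¹ hprim'
    rw [Complex.star_def, Complex.mul_conj'] at h
    unfold gauss
    exact_mod_cast h
  have hpos : (0 : ℝ) < Fintype.card R := by exact_mod_cast Fintype.card_pos
  have hgn : ‖gauss ω ψ‖ = Real.sqrt (Fintype.card R) := by
    rw [← hg, Real.sqrt_sq (norm_nonneg _)]
  have hκ : ‖kappaHalf R‖ = (Real.sqrt (Fintype.card R))⁻¹ := by
    unfold kappaHalf
    rw [Complex.norm_real, Real.norm_eq_abs, abs_of_pos (kappaHalf_pos R)]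
  rw [eps_kappaHalf, norm_mul, norm_mul, norm_pow, hπ, one_pow, one_mul, hκ, hgn,
    inv_mul_cancel₀ (Real.sqrt_pos.mpr hpos).ne']

/-- **THE LOCAL SIGN IS A SIGN, with the page's normalisation and the conjugation**: `ε(½, ω) = ±1` for a primitive
`ω` of any conductor on the local-ring model, `κ = kappaHalf R`, conjugate duality from `σ, s, t` (`t s = −1`) — no
normalisation hypothesis left; the model transcription is the only input. -/
theorem eps_kappaHalf_eq_one_or_neg_one (n : ℕ) (ω : LocalChar R) (ψ : AddChar R ℂ) (hψ : ψ.IsPrimitive)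
    (𝔪 : Ideal R) (hloc : ∀ x : R, x ∈ 𝔪 ↔ ¬ IsUnit x) (hA : ∀ t, PsiAnn ψ 𝔪 t → t ∈ 𝔪)
    (hsq : ∀ t t', PsiAnn ψ 𝔪 t → PsiAnn ψ 𝔪 t' → t * t' = 0)
    (hprim : ∃ z₀, PsiAnn ψ 𝔪 z₀ ∧ ω.unit (1 + z₀) ≠ 1) (hπ : ω.piVal ≠ 0) (σ : R ≃+* R) (s t : Rˣ)
    (hσψ : ∀ x : R, ψ (σ x) = ψ ((s : R) * x)) (hσω : ∀ x : R, ω.unit (σ x) = ω.unit⁻¹ x)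
    (hπσ : ω.piVal⁻¹ ^ n = ω.unit t * ω.piVal ^ n) (hts : (t : R) * s = -1) :
    eps (kappaHalf R) n ω ψ = 1 ∨ eps (kappaHalf R) n ω ψ = -1 := by
  haveI : Nonempty R := ⟨0⟩
  exact eps_eq_one_or_neg_one_local (kappaHalf R) n ω ψ hψ 𝔪 hloc hA hsq hprim hπ
    (kappaHalf_sq_mul_card R) (conjDual_of_conjugation (kappaHalf R) n ω ψ σ s t hσψ hσω hπσ hts)

end LocalChar

end Summit.Ventures.HodgeRepro.PeriodCloser

end
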